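import Summits.MatrixMultiplication.OmegaCensus.STPPOrbitFamilies

/-!
# ω-census TOOL law: MULTI-ORBIT FAMILIES for the simultaneous triple product property (stpp-3 gen 18)

HONEST FRAMING (pub-omega census; verbatim): lottery ticket; floor = certified bounds/negative ranges.
Census STRUCTURE bookkeeping (question Q7 of the pub-omega cell), not progress on `ω`: an STPP family of 2-subsets certifies no
matrix-multiplication bound of interest.  This file records, in the kernel, the CRITERION behind the seat's 'two-orbit' / 'mixed-orbit'
searches (`orb2x.c`, stpp-3 gen 16/17: first two-orbit find `(2,2,2)⁸ ⊆ ℤ/195`, kernel `STPP222Pow8SeedsM`; `orbmix.c` type strings `G…G`,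
gen 17/18; the uniform rotation families `STPP222Pow6RotationFamily` / `STPP222Pow8RotationFamily` are two-orbit families of this kind), as
the several-base-triples companion of `OrbitFamily.isSTPP_image` (`STPPOrbitFamilies.lean`, one base triple).

**Multi-orbit criterion.**  Let `e : Fin N → (H ≃+ H)` enumerate injectively a set of additive automorphisms of an abelian group `H`
containing the identity `e i₀` and closed under `(κ, κ') ↦ κ⁻¹ ∘ κ'` (a subgroup `K ≤ Aut H` of order `N`, stated pointwise), and let
`(A j, B j, C j)_{j < m}` be base triples.  Consider ANY family `p ↦ (e (γ p) '' A (β p), e (γ p) '' B (β p), e (γ p) '' C (β p))` indexed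
by `p : Fin M` through a pair of index maps `(β, γ) : Fin M → Fin m × Fin N` that is jointly injective (a union of `K`-orbits of the base
triples, or any sub-family of it).  If every base triple has the (additive) triple product property and, for all base patterns
`(j₁, j₂, j₃)` and automorphism pairs `(λ, μ)` OTHER than `j₁ = j₂ = j₃ ∧ λ = μ = e i₀`,
`(x′ − y) + e λ (y′ − z) + e μ (z′ − x) ≠ 0` for `x ∈ A j₃`, `x′ ∈ A j₁`, `y ∈ B j₁`, `y′ ∈ B j₂`, `z ∈ C j₂`, `z′ ∈ C j₃`,
then the family satisfies `IsSTPP` (CKSU 2005 Def. 5.1, tree form).  Proof: the Def-5.1 word of the member triple `(p, q, r)` equals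
`e (γ p)` applied to `(x′ − y) + λ (y′ − z) + μ (z′ − x)` with `λ = (e (γ p))⁻¹ ∘ e (γ q)`, `μ = (e (γ p))⁻¹ ∘ e (γ r)` and base pattern
`(β p, β q, β r)`; a zero forces the excluded pattern, whence `γ q = γ p`, `γ r = γ p` (injectivity of `e`), `β p = β q = β r`, so
`p = q = r` (joint injectivity) and the TPP word of the base triple `β p` finishes.  With `m = 1`, `β` constant and `γ = id` this is
`OrbitFamily.isSTPP_image`.  The arithmetic point is the same: `m³ · N² · |A−B| · |B−C| · |C−A|` sums decide a family of `M ≤ m · N`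
triples whose literal check has `M³ · 64` words (for 2-sets), and a search runs over `5m` group elements.  No claim beyond the implication
(nothing about which `K`, `m` admit base triples; half-orbits of symmetric triples under `−1 ∈ K` are NOT covered by this statement).

References: H. Cohn, R. Kleinberg, B. Szegedy, C. Umans, FOCS 2005 (arXiv:math/0511460), Def. 5.1.  Seat pub-omega-stpp-3 (gen 18),
2026-08-26; engines HOME `pub-omega-stpp-3-g17/code/kit-halforbit2/orbmix.c`, `pub-omega-stpp-3-g18/code/kit-orbit-low/`.
-/

open Literature.Computability.AlgebraicComplexity Finset

namespace Summit.MatrixMultiplication.OmegaCensus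

namespace OrbitFamily

/-- **Multi-orbit criterion for the simultaneous TPP** (census TOOL law; several base triples, any jointly-injective sub-family of
the union of their `K`-orbits).  `e` enumerates injectively a set of additive automorphisms containing the identity `e i₀` and closed
under `κ⁻¹ ∘ κ'` (`hcl`), all pointwise; `β, γ` pick the base triple and the automorphism of member `p` and are jointly injective
(`hβγ`); `htpp` is the additive TPP of every base triple; `horb` is the block condition for every base pattern and automorphism pair
other than the diagonal identity one.  Conclusion: the family of images satisfies `IsSTPP`. [cite: CohnKleinbergSzegedyUmans2005, Def. 5.1] -/
theorem isSTPP_image_multi {H : Type*} [AddCommGroup H] [DecidableEq H] {N m M : ℕ}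
    (e : Fin N → H ≃+ H) (i₀ : Fin N) (he₀ : ∀ w, e i₀ w = w) (hinj : ∀ i j : Fin N, (∀ w, e i w = e j w) → i = j)
    (hcl : ∀ i j : Fin N, ∃ n : Fin N, ∀ w, (e i).symm (e j w) = e n w)
    (A B C : Fin m → Finset H) (β : Fin M → Fin m) (γ : Fin M → Fin N)
    (hβγ : ∀ p q : Fin M, β p = β q → γ p = γ q → p = q)
    (htpp : ∀ j, ∀ x ∈ A j, ∀ x' ∈ A j, ∀ y ∈ B j, ∀ y' ∈ B j, ∀ z ∈ C j, ∀ z' ∈ C j,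
      (x' - x) + (y' - y) + (z' - z) = 0 → x = x' ∧ y = y' ∧ z = z')
    (horb : ∀ j₁ j₂ j₃ : Fin m, ∀ l n : Fin N, ¬ (j₁ = j₂ ∧ j₂ = j₃ ∧ l = i₀ ∧ n = i₀) →
      ∀ x ∈ A j₃, ∀ x' ∈ A j₁, ∀ y ∈ B j₁, ∀ y' ∈ B j₂, ∀ z ∈ C j₂, ∀ z' ∈ C j₃,
      (x' - y) + e l (y' - z) + e n (z' - x) ≠ 0) :
    IsSTPP (fun p => (A (β p)).image (e (γ p))) (fun p => (B (β p)).image (e (γ p)))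
      (fun p => (C (β p)).image (e (γ p))) := by
  intro i j k s hs s' hs' t ht t' ht' u hu u' hu' hsum
  simp only [Finset.mem_image] at hs hs' ht ht' hu hu'
  obtain ⟨x, hx, rfl⟩ := hs
  obtain ⟨x', hx', rfl⟩ := hs'
  obtain ⟨y, hy, rfl⟩ := ht
  obtain ⟨y', hy', rfl⟩ := ht'
  obtain ⟨z, hz, rfl⟩ := hu
  obtain ⟨z', hz', rfl⟩ := hu'
  obtain ⟨l, hl⟩ := hcl (γ i) (γ j)
  obtain ⟨n, hn⟩ := hcl (γ i) (γ k)
  have hii : ∀ w, (e (γ i)).symm (e (γ i) w) = w := fun w => (e (γ i)).symm_apply_apply w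
  -- pull the word back along `e (γ i)`
  have h2 : (e (γ i)).symm ((e (γ i) x' - e (γ k) x) + (e (γ j) y' - e (γ i) y) + (e (γ k) z' - e (γ j) z)) = 0 := by
    rw [hsum, map_zero]
  simp only [map_add, map_sub, hii, hl, hn] at h2
  have key : (x' - y) + e l (y' - z) + e n (z' - x) = 0 := by
    calc (x' - y) + e l (y' - z) + e n (z' - x)
        = (x' - e n x) + (e l y' - y) + (e n z' - e l z) := by simp only [map_sub]; abel
      _ = 0 := h2
  by_cases hdiag : β i = β j ∧ β j = β k ∧ l = i₀ ∧ n = i₀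
  · obtain ⟨hij, hjk, hl0, hn0⟩ := hdiag
    subst hl0; subst hn0
    -- `e (γ j) = e (γ i)` and `e (γ k) = e (γ i)`, hence `γ j = γ i`, `γ k = γ i`
    have hji : γ j = γ i := by
      refine hinj (γ j) (γ i) fun w => ?_
      have h := hl w
      rw [he₀, AddEquiv.symm_apply_eq] at h
      exact h
    have hki : γ k = γ i := by
      refine hinj (γ k) (γ i) fun w => ?_
      have h := hn w
      rw [he₀, AddEquiv.symm_apply_eq] at h
      exact h
    have hpij : i = j := hβγ i j hij hji.symm
    have hpjk : j = k := hβγ j k hjk (hji.trans hki.symm)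
    subst hpij; subst hpjk
    rw [he₀, he₀] at key
    have key' : (x' - x) + (y' - y) + (z' - z) = 0 := by
      calc (x' - x) + (y' - y) + (z' - z) = (x' - y) + (y' - z) + (z' - x) := by abel
        _ = 0 := key
    obtain ⟨rfl, rfl, rfl⟩ := htpp (β i) x hx x' hx' y hy y' hy' z hz z' hz' key'
    exact ⟨rfl, rfl, rfl, rfl, rfl⟩
  · exact absurd key (horb (β i) (β j) (β k) l n hdiag x hx x' hx' y hy y' hy' z hz z' hz')

/-- Packaged form for the census statements: a jointly-injective multi-orbit family of base triples of `2`-subsets is a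
`(2,2,2)^M` witness (images under automorphisms keep cardinality `2`). [cite: CohnKleinbergSzegedyUmans2005, Def. 5.1] -/
theorem exists_isSTPP_222pow_multi {H : Type*} [AddCommGroup H] [DecidableEq H] {N m M : ℕ}
    (e : Fin N → H ≃+ H) (i₀ : Fin N) (he₀ : ∀ w, e i₀ w = w) (hinj : ∀ i j : Fin N, (∀ w, e i w = e j w) → i = j)
    (hcl : ∀ i j : Fin N, ∃ n : Fin N, ∀ w, (e i).symm (e j w) = e n w)
    (A B C : Fin m → Finset H) (hA : ∀ j, (A j).card = 2) (hB : ∀ j, (B j).card = 2) (hC : ∀ j, (C j).card = 2)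
    (β : Fin M → Fin m) (γ : Fin M → Fin N) (hβγ : ∀ p q : Fin M, β p = β q → γ p = γ q → p = q)
    (htpp : ∀ j, ∀ x ∈ A j, ∀ x' ∈ A j, ∀ y ∈ B j, ∀ y' ∈ B j, ∀ z ∈ C j, ∀ z' ∈ C j,
      (x' - x) + (y' - y) + (z' - z) = 0 → x = x' ∧ y = y' ∧ z = z')
    (horb : ∀ j₁ j₂ j₃ : Fin m, ∀ l n : Fin N, ¬ (j₁ = j₂ ∧ j₂ = j₃ ∧ l = i₀ ∧ n = i₀) →
      ∀ x ∈ A j₃, ∀ x' ∈ A j₁, ∀ y ∈ B j₁, ∀ y' ∈ B j₂, ∀ z ∈ C j₂, ∀ z' ∈ C j₃,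
      (x' - y) + e l (y' - z) + e n (z' - x) ≠ 0) :
    ∃ A' B' C' : Fin M → Finset H, IsSTPP A' B' C' ∧ ∀ p, (A' p).card = 2 ∧ (B' p).card = 2 ∧ (C' p).card = 2 :=
  ⟨_, _, _, isSTPP_image_multi e i₀ he₀ hinj hcl A B C β γ hβγ htpp horb, fun p =>
    ⟨(Finset.card_image_of_injective _ (e (γ p)).injective).trans (hA (β p)),
     (Finset.card_image_of_injective _ (e (γ p)).injective).trans (hB (β p)),
     (Finset.card_image_of_injective _ (e (γ p)).injective).trans (hC (β p))⟩⟩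

/-- The one-base-triple orbit criterion `isSTPP_image` is the case `m = 1`, `β` constant, `γ = id` of the multi-orbit criterion
(consistency check of the two TOOL statements; the family is literally the same function). [cite: CohnKleinbergSzegedyUmans2005, Def. 5.1] -/
theorem isSTPP_image_of_multi {H : Type*} [AddCommGroup H] [DecidableEq H] {N : ℕ}
    (e : Fin N → H ≃+ H) (i₀ : Fin N) (he₀ : ∀ w, e i₀ w = w) (hinj : ∀ i j : Fin N, (∀ w, e i w = e j w) → i = j)
    (hcl : ∀ i j : Fin N, ∃ n : Fin N, ∀ w, (e i).symm (e j w) = e n w)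
    (A B C : Finset H)
    (htpp : ∀ x ∈ A, ∀ x' ∈ A, ∀ y ∈ B, ∀ y' ∈ B, ∀ z ∈ C, ∀ z' ∈ C,
      (x' - x) + (y' - y) + (z' - z) = 0 → x = x' ∧ y = y' ∧ z = z')
    (horb : ∀ l n : Fin N, ¬ (l = i₀ ∧ n = i₀) → ∀ x ∈ A, ∀ x' ∈ A, ∀ y ∈ B, ∀ y' ∈ B, ∀ z ∈ C, ∀ z' ∈ C,
      (x' - y) + e l (y' - z) + e n (z' - x) ≠ 0) :
    IsSTPP (fun i => A.image (e i)) (fun i => B.image (e i)) (fun i => C.image (e i)) :=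
  isSTPP_image_multi e i₀ he₀ hinj hcl (fun _ : Fin 1 => A) (fun _ => B) (fun _ => C) (fun _ => 0) id
    (fun _ _ _ h => h) (fun _ => htpp)
    (fun _ _ _ l n hne => horb l n fun h => hne ⟨Subsingleton.elim _ _, Subsingleton.elim _ _, h.1, h.2⟩)

/-- **Mixed-orbit criterion (free orbits AND half-orbits; the kernel form of the unified engine `orbmix.c`).**  As in
`isSTPP_image_multi`, plus: `e i₁` is negation (`−1 ∈ K`), a predicate `S` marks the 'symmetric' base levels, and on those levels the
chosen members are a TRANSVERSAL for `±` (`htrans`: no two members of the same `S`-level differ by the automorphism `−1`).  Then the block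
condition may be omitted, on the diagonal pattern of an `S`-level, for all FOUR pairs `(λ, μ) ∈ {id, −id}²` (for symmetric 2-sets `{±a}`
these four blocks always contain a zero, which is why the engine skips them): a zero word there forces `λ = ±id`; `−id` contradicts the
transversal hypothesis and `id` gives equal members, so the TPP of the base triple finishes.  No symmetry of the sets is assumed — it is
not needed for the implication (it only makes the omitted blocks unavoidable and the `λ ↔ −λ` blocks redundant in the search).  With
`S = ⊥` this is `isSTPP_image_multi`. [cite: CohnKleinbergSzegedyUmans2005, Def. 5.1] -/
theorem isSTPP_image_mixed {H : Type*} [AddCommGroup H] [DecidableEq H] {N m M : ℕ}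
    (e : Fin N → H ≃+ H) (i₀ i₁ : Fin N) (he₀ : ∀ w, e i₀ w = w) (he₁ : ∀ w, e i₁ w = -w)
    (hinj : ∀ i j : Fin N, (∀ w, e i w = e j w) → i = j)
    (hcl : ∀ i j : Fin N, ∃ n : Fin N, ∀ w, (e i).symm (e j w) = e n w)
    (A B C : Fin m → Finset H) (S : Fin m → Prop) (β : Fin M → Fin m) (γ : Fin M → Fin N)
    (hβγ : ∀ p q : Fin M, β p = β q → γ p = γ q → p = q)
    (htrans : ∀ p q : Fin M, S (β p) → β p = β q → (∀ w, e (γ q) w = - e (γ p) w) → False)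
    (htpp : ∀ j, ∀ x ∈ A j, ∀ x' ∈ A j, ∀ y ∈ B j, ∀ y' ∈ B j, ∀ z ∈ C j, ∀ z' ∈ C j,
      (x' - x) + (y' - y) + (z' - z) = 0 → x = x' ∧ y = y' ∧ z = z')
    (horb : ∀ j₁ j₂ j₃ : Fin m, ∀ l n : Fin N,
      ¬ (j₁ = j₂ ∧ j₂ = j₃ ∧ ((l = i₀ ∧ n = i₀) ∨ (S j₁ ∧ (l = i₀ ∨ l = i₁) ∧ (n = i₀ ∨ n = i₁)))) →
      ∀ x ∈ A j₃, ∀ x' ∈ A j₁, ∀ y ∈ B j₁, ∀ y' ∈ B j₂, ∀ z ∈ C j₂, ∀ z' ∈ C j₃,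
      (x' - y) + e l (y' - z) + e n (z' - x) ≠ 0) :
    IsSTPP (fun p => (A (β p)).image (e (γ p))) (fun p => (B (β p)).image (e (γ p)))
      (fun p => (C (β p)).image (e (γ p))) := by
  intro i j k s hs s' hs' t ht t' ht' u hu u' hu' hsum
  simp only [Finset.mem_image] at hs hs' ht ht' hu hu'
  obtain ⟨x, hx, rfl⟩ := hs
  obtain ⟨x', hx', rfl⟩ := hs'
  obtain ⟨y, hy, rfl⟩ := ht
  obtain ⟨y', hy', rfl⟩ := ht'
  obtain ⟨z, hz, rfl⟩ := hu
  obtain ⟨z', hz', rfl⟩ := hu'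
  obtain ⟨l, hl⟩ := hcl (γ i) (γ j)
  obtain ⟨n, hn⟩ := hcl (γ i) (γ k)
  have hii : ∀ w, (e (γ i)).symm (e (γ i) w) = w := fun w => (e (γ i)).symm_apply_apply w
  have h2 : (e (γ i)).symm ((e (γ i) x' - e (γ k) x) + (e (γ j) y' - e (γ i) y) + (e (γ k) z' - e (γ j) z)) = 0 := by
    rw [hsum, map_zero]
  simp only [map_add, map_sub, hii, hl, hn] at h2
  have key : (x' - y) + e l (y' - z) + e n (z' - x) = 0 := by
    calc (x' - y) + e l (y' - z) + e n (z' - x)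
        = (x' - e n x) + (e l y' - y) + (e n z' - e l z) := by simp only [map_sub]; abel
      _ = 0 := h2
  -- from `(e (γ i)).symm ∘ e (γ j) = e l`: `l = i₀` gives `γ j = γ i`, `l = i₁` gives `e (γ j) = - e (γ i)`
  have hl0 : l = i₀ → γ j = γ i := fun h0 => by
    subst h0
    refine hinj (γ j) (γ i) fun w => ?_
    have h := hl w
    rw [he₀, AddEquiv.symm_apply_eq] at h
    exact h
  have hn0 : n = i₀ → γ k = γ i := fun h0 => by
    subst h0
    refine hinj (γ k) (γ i) fun w => ?_
    have h := hn w
    rw [he₀, AddEquiv.symm_apply_eq] at h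
    exact h
  have hl1 : l = i₁ → ∀ w, e (γ j) w = - e (γ i) w := fun h1 w => by
    subst h1
    have h := hl w
    rw [he₁, AddEquiv.symm_apply_eq, map_neg] at h
    exact h
  have hn1 : n = i₁ → ∀ w, e (γ k) w = - e (γ i) w := fun h1 w => by
    subst h1
    have h := hn w
    rw [he₁, AddEquiv.symm_apply_eq, map_neg] at h
    exact h
  by_cases hdiag : β i = β j ∧ β j = β k ∧ ((l = i₀ ∧ n = i₀) ∨ (S (β i) ∧ (l = i₀ ∨ l = i₁) ∧ (n = i₀ ∨ n = i₁)))
  · obtain ⟨hij, hjk, hrest⟩ := hdiag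
    -- in either branch, `l = i₀` and `n = i₀` (the `i₁` alternatives contradict the transversal hypothesis)
    have hl00 : l = i₀ := by
      rcases hrest with ⟨h, _⟩ | ⟨hS, hl', _⟩
      · exact h
      · rcases hl' with h | h
        · exact h
        · exact (htrans i j hS hij (hl1 h)).elim
    have hn00 : n = i₀ := by
      rcases hrest with ⟨_, h⟩ | ⟨hS, _, hn'⟩
      · exact h
      · rcases hn' with h | h
        · exact h
        · exact (htrans i k hS (hij.trans hjk) (hn1 h)).elim
    have hji : γ j = γ i := hl0 hl00
    have hki : γ k = γ i := hn0 hn00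
    have hpij : i = j := hβγ i j hij hji.symm
    have hpjk : j = k := hβγ j k hjk (hji.trans hki.symm)
    subst hpij; subst hpjk; subst hl00; subst hn00
    rw [he₀, he₀] at key
    have key' : (x' - x) + (y' - y) + (z' - z) = 0 := by
      calc (x' - x) + (y' - y) + (z' - z) = (x' - y) + (y' - z) + (z' - x) := by abel
        _ = 0 := key
    obtain ⟨rfl, rfl, rfl⟩ := htpp (β i) x hx x' hx' y hy y' hy' z hz z' hz' key'
    exact ⟨rfl, rfl, rfl, rfl, rfl⟩
  · exact absurd key (horb (β i) (β j) (β k) l n hdiag x hx x' hx' y hy y' hy' z hz z' hz')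

/-- Packaged form of the mixed-orbit criterion for the census statements (2-subsets). [cite: CohnKleinbergSzegedyUmans2005, Def. 5.1] -/
theorem exists_isSTPP_222pow_mixed {H : Type*} [AddCommGroup H] [DecidableEq H] {N m M : ℕ}
    (e : Fin N → H ≃+ H) (i₀ i₁ : Fin N) (he₀ : ∀ w, e i₀ w = w) (he₁ : ∀ w, e i₁ w = -w)
    (hinj : ∀ i j : Fin N, (∀ w, e i w = e j w) → i = j)
    (hcl : ∀ i j : Fin N, ∃ n : Fin N, ∀ w, (e i).symm (e j w) = e n w)
    (A B C : Fin m → Finset H) (hA : ∀ j, (A j).card = 2) (hB : ∀ j, (B j).card = 2) (hC : ∀ j, (C j).card = 2)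
    (S : Fin m → Prop) (β : Fin M → Fin m) (γ : Fin M → Fin N)
    (hβγ : ∀ p q : Fin M, β p = β q → γ p = γ q → p = q)
    (htrans : ∀ p q : Fin M, S (β p) → β p = β q → (∀ w, e (γ q) w = - e (γ p) w) → False)
    (htpp : ∀ j, ∀ x ∈ A j, ∀ x' ∈ A j, ∀ y ∈ B j, ∀ y' ∈ B j, ∀ z ∈ C j, ∀ z' ∈ C j,
      (x' - x) + (y' - y) + (z' - z) = 0 → x = x' ∧ y = y' ∧ z = z')
    (horb : ∀ j₁ j₂ j₃ : Fin m, ∀ l n : Fin N,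
      ¬ (j₁ = j₂ ∧ j₂ = j₃ ∧ ((l = i₀ ∧ n = i₀) ∨ (S j₁ ∧ (l = i₀ ∨ l = i₁) ∧ (n = i₀ ∨ n = i₁)))) →
      ∀ x ∈ A j₃, ∀ x' ∈ A j₁, ∀ y ∈ B j₁, ∀ y' ∈ B j₂, ∀ z ∈ C j₂, ∀ z' ∈ C j₃,
      (x' - y) + e l (y' - z) + e n (z' - x) ≠ 0) :
    ∃ A' B' C' : Fin M → Finset H, IsSTPP A' B' C' ∧ ∀ p, (A' p).card = 2 ∧ (B' p).card = 2 ∧ (C' p).card = 2 :=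
  ⟨_, _, _, isSTPP_image_mixed e i₀ i₁ he₀ he₁ hinj hcl A B C S β γ hβγ htrans htpp horb, fun p =>
    ⟨(Finset.card_image_of_injective _ (e (γ p)).injective).trans (hA (β p)),
     (Finset.card_image_of_injective _ (e (γ p)).injective).trans (hB (β p)),
     (Finset.card_image_of_injective _ (e (γ p)).injective).trans (hC (β p))⟩⟩

/-- The free-orbit criterion is the mixed criterion with no symmetric level (`S = ⊥`; the negation index and the transversal
hypothesis become idle). [cite: CohnKleinbergSzegedyUmans2005, Def. 5.1] -/
theorem isSTPP_image_multi_of_mixed {H : Type*} [AddCommGroup H] [DecidableEq H] {N m M : ℕ}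
    (e : Fin N → H ≃+ H) (i₀ i₁ : Fin N) (he₀ : ∀ w, e i₀ w = w) (he₁ : ∀ w, e i₁ w = -w)
    (hinj : ∀ i j : Fin N, (∀ w, e i w = e j w) → i = j)
    (hcl : ∀ i j : Fin N, ∃ n : Fin N, ∀ w, (e i).symm (e j w) = e n w)
    (A B C : Fin m → Finset H) (β : Fin M → Fin m) (γ : Fin M → Fin N)
    (hβγ : ∀ p q : Fin M, β p = β q → γ p = γ q → p = q)
    (htpp : ∀ j, ∀ x ∈ A j, ∀ x' ∈ A j, ∀ y ∈ B j, ∀ y' ∈ B j, ∀ z ∈ C j, ∀ z' ∈ C j,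
      (x' - x) + (y' - y) + (z' - z) = 0 → x = x' ∧ y = y' ∧ z = z')
    (horb : ∀ j₁ j₂ j₃ : Fin m, ∀ l n : Fin N, ¬ (j₁ = j₂ ∧ j₂ = j₃ ∧ l = i₀ ∧ n = i₀) →
      ∀ x ∈ A j₃, ∀ x' ∈ A j₁, ∀ y ∈ B j₁, ∀ y' ∈ B j₂, ∀ z ∈ C j₂, ∀ z' ∈ C j₃,
      (x' - y) + e l (y' - z) + e n (z' - x) ≠ 0) :
    IsSTPP (fun p => (A (β p)).image (e (γ p))) (fun p => (B (β p)).image (e (γ p)))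
      (fun p => (C (β p)).image (e (γ p))) :=
  isSTPP_image_mixed e i₀ i₁ he₀ he₁ hinj hcl A B C (fun _ => False) β γ hβγ (fun _ _ h _ _ => h.elim) htpp
    (fun j₁ j₂ j₃ l n hne => horb j₁ j₂ j₃ l n fun h => hne ⟨h.1, h.2.1, Or.inl ⟨h.2.2.1, h.2.2.2⟩⟩)

end OrbitFamily

end Summit.MatrixMultiplication.OmegaCensus
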